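import Literature.MathematicalPhysics.QuantumFieldTheory.Balaban1983to89.B9Thm311FlatPositivityZdPer

/-!
# `Balaban1983to89.B9Eq316AveragingSquaresZdPer` — [Balaban1985BackgroundPropagators] (3.16)–(3.17) AT A CURVED BACKGROUND ON THE TORUS `T_P` READ ON `ℤᵈ`:
# the composite averaging `LʲηQ_j(U₀)` is `ℂ`-LINEAR ON ALL BOND FIELDS at a class bond for `U₀` in the class (1.7) (locality + lit-balaban's `linCovIter_line`),
# so `⟨A, Q*aQ(U₀)A⟩_per = η·Σ_j w_j Σ Re τ|LʲηQ_j(U₀)A|² ≥ 0` at EVERY periodic background of the class; the curvature letter `Δ′(U₀)` VANISHES AT EVERY FLAT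
# background (any holonomy); hence `⟨A, Δ_a(U₀)A⟩_per` of the genuine torus record `opsAllZdPer` = three squares + the signed curvature term, Theorem 3.11 at a
# curved `U₀` reduces to dominating that one term, and at a flat background with ARBITRARY holonomy the kernel conditions (closed ∕ Landau ∕ class averages) hold

statement-level skeleton of published theorems with citation tags; proofs where landed; nothing here is a claim about the
Yang–Mills mass gap

`[Balaban1985BackgroundPropagators]` ("B9", CMP **99** (1985) 389–434) (3.16)–(3.17) p. 393 (the averaging term `⟨A, Q*aQA⟩` as a weighted sum of `|Λ_jQ_jA|²` over the
`j`-lattices — print's weight `(Lʲη)^{d−2}` per bond; the tree's letter `QQZdP` carries [B8] (1.58)'s normalisation `w_j = wQ L η j > 0`, which is all positivity uses),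
(3.10) p. 392 («Δ = D*D + Δ′», every letter of `Δ′` weighted by `Re U(∂p) − 1` or `Im U(∂p)`), (3.26) p. 395, (3.20)–(3.22) p. 394, Thm 3.11 p. 416 (*«the operators
Δ′_a, G′, (Q′G′²Q′*)⁻¹, Δ_a, G are positive definite»*).  `[Balaban1985Averaging]` ("B7", CMP **98**) p. 38 (*«Q_{j+1}(U₀) = Q(Ū₀ʲ)Q_j(U₀)»*, each factor linear),
(147) p. 40, (153) p. 41, p. 24 (locality), Prop. 1 (51) p. 26.  `[Balaban1985RegularSpaces]` ("B8") (1.7) p. 77, (1.31) p. 82, (1.56), (1.58) p. 86, p. 77 («Ω_j = T_η»).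
`[Balaban1984PropagatorsI]` (1.72) p. 30.  PDF held: `paper:balaban1985-cmp99-background-propagators` pp. 392–395, 416 (via the lineage's docstrings, re-read 2026-08-28).

CITATION HEADER (lean-in-tree rule).  Cell `pub-ymgap` (YM Track A, HUMAN RULINGS D-0062 ∕ D-0149), node N06 = [B9]; seat `pub-ymgap-dag-n06-b` (g23), junction ∕ letter
lineage of J-N06→N05 and owner of the N06 object layer of the (β′-PERIODIC) road; CLAIM-3 (own take after LANDED-1 p645632 `B9Thm311FlatPositivityZdPer` and this seat's
LOCATED-SELF-8, bus 2026-08-28 16:02Z: the torus class (1.7) contains FLAT backgrounds with non-trivial holonomy, not gauge-equivalent to `1`).  WHY.  p645632 §3 stopped,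
at a CURVED background, at the pairing form `Σ_j w_j Σ ⟨(𝟙_{Λ_j}LʲηQ_j(U₀)A), LʲQ_j(U₀)A⟩_τ` because the `ℂ`-homogeneity `Q_j(U₀)(iηA) = iη·Q_j(U₀)A` was in the tree only at
`U₀ = 1` (`linCovIter_one_smul_complex`, bounded fields).  §1 proves it — and full `ℂ`-linearity on ALL fields — at every `U₀` of the class (1.7), by locality (the composite at a
class bond reads only the box of the bond; clamp the background there, where lit-balaban's `B7Prop5GeneralLinear.linCovIter_line` applies).  Consequences: the averaging term of
(3.26) is a sum of squares, hence `≥ 0`, at every periodic class background (§2); with §3 (`Δ′(U₀) = 0` at every flat `U₀`) the form of the genuine record is «three squares +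
one signed term» (§4), which is (i) the reduction dag-n06-w3∕-w4's curved roads perturb (only `⟨A, Δ′(U₀)A⟩_per` is signed) and (ii) the first step of Theorem 3.11 at the flat
backgrounds WITH HOLONOMY that a per-member compactness witness of `InvAtHIPer` on `T_P` needs (LOCATED-SELF-8): there the kernel conditions hold exactly as at `U₀ = 1`
(§4 ★★★), and what remains is the twisted Hodge kernel (not here).

WHAT IS PROVED (kernel, 0 sorry; theorems only (+ four private plumbing lemmas); no `def`, no `instance`, no `notation`).
* §1 (class-general, `ℤᵈ`) ★★ `linCovIter_line_of_reg17` (`LʲηQ_j(U₀)(B + tD)(c) = LʲηQ_j(U₀)B(c) + t·LʲηQ_j(U₀)D(c)` for ALL `B, D`, `t ∈ ℂ`, at a class bond `c`, `U₀`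
  unitary in `Reg17 L m Ω α U₀`, `α ≤ α_Q`), ★ `linCovIter_add_of_reg17`, ★ `linCovIter_csmul_of_reg17`, ★ `clsField_eq_smul_of_reg17` (`𝟙_{Λ_j}·(−i)·LʲηQ_j(U₀)(iηA) =
  η·𝟙_{Λ_j}·LʲηQ_j(U₀)A` at every class background).
* §2 (torus) ★★★ `bondPairPer_QQZdP_eq_squares` (curved periodic `U₀` in the letter's regime: `⟨A, Q*aQ(U₀)A⟩_per = η Σ_{j≤m} w_j Σ_κ Σ_{y∈[0,P∕Lʲ)ᵈ,(y,κ)∈Λ_j}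
  Re τ|LʲηQ_j(U₀)A|²`), ★★ `bondPairPer_QQZdP_nonneg`, ★★ `linCovIter_eq_zero_of_bondPairPer_QQZdP_nonpos`.
* §3 ★ `DpZd_eq_zero_of_plaqF_eq_one` (`Δ′(U₀) = 0` whenever every plaquette variable is `1`), `reg17_of_plaqF_eq_one`.
* §4 (genuine torus record `opsAllZdPer`) ★★ `bondPairPer_deltaAOf_opsAllZdPer_eq_squares` (`= Σ|D^η_{U₀}A|² + ⟨A,Δ′(U₀)A⟩_per + ‖R^per(U₀)D*A‖²_per + η Σ w_j Σ|LʲηQ_j(U₀)A|²`),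
  ★★ `regularAtHPer_opsAllZdPer_of_curv_dominated` (Thm 3.11 at a curved periodic `U₀` ⟸ `−⟨A,Δ′(U₀)A⟩_per <` the three squares on `E_𝔤^per(P) ∖ 0`),
  ★★★ `kernel_conditions_per_of_flat_of_bondPairPer_nonpos` (flat `U₀` with ANY holonomy: `⟨A,Δ_a(U₀)A⟩_per ≤ 0` ⟹ covariantly closed on the cell ∧
  `R^per(U₀)D^{η*}_{U₀}A = 0` ∧ class averages of `Q_j(U₀)A` vanish on the coarse cells).

HONEST SCOPE.  (i) Algebra + locality bookkeeping; NO estimate of [B9]; Theorem 3.11 at a curved or flat-with-holonomy `U₀` is NOT proved — §4 isolates what it needs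
(domination of the curvature term, resp. the twisted Hodge kernel on `T_P`); no uniformity in the member.  (ii) Count-neutral (`--supports` the K1 item of record); N05 ∕ N06
NOT discharged; K1⁹ NOT closed; counts UNMOVED; one finite `𝕋⁴` programme at fixed `ε`, Bałaban as printed; R4 closes only the conditional finite-`𝕋⁴` rung `BalabanLadder.UV`
— nothing continuum ∕ ℝ⁴ ∕ OS ∕ mass gap ∕ Clay.  Unit `pub-ymgap-dag-n06-b` (g23), 2026-08-28; NEW file importing this seat's `B9Thm311FlatPositivityZdPer` (p645632);
modifies nothing.  Net new unproved facts: 0.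
-/

noncomputable section

open scoped BigOperators

namespace Literature.MathematicalPhysics.QuantumFieldTheory.Balaban1983to89.B9Eq316AveragingSquaresZdPer

open B7Prop1Explicit B7Eq78Linearization
open B7Prop1Local (InBox loK bondHiK AgreeOn clampCfg clampCfg_mem clampCfg_agree pdev_clampCfg_le)
open B7Prop2Explicit (unitaryUnits avgClosed_unitaryUnits pdev C0 c2' C0_pos)
open B7Prop5Flat (bump boxFinset mem_boxFinset)
open B7Prop4GeneralLevels (linCovIter)
open B7Prop5GeneralLevels (thetaGen hadd_levels hsmul_levels)
open B7Prop5GeneralLinear (linCovIter_line)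
open B8Ineq132 (covDerivFwd covDeriv plaqF pdevOn_lt_of_forall InAk)
open B8Eq133Hypotheses (shiftT byDir)
open B8Eq146AExpansion (plaqCovDeriv iEta)
open B8Eq138LandauZd (covDivB covLap)
open B8Eq155JBound (Jcur)
open B8LeafModelZd (ZdIdx)
open B8Eq119TwistedAxial (bgT bgT_one)
open T4TermwiseTorus (IsPeriodic box mem_box tcls tlift tlift_mem_box)
open B9Eq39Adjoint (plaqU)
open B9Eq310Hermitian (deltaPrimeOp)
open B9SupplySockB9P3ZdLetters (OpsZd deltaAOf)
open B9Eq316AveragingTransposeZd (tauForm tauForm_apply linCovIterT clsField wQ Reg17 alphaQ alphaQ_pos reg17_one C0_mul_alphaQ_le four_mul_alphaQ_le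
  tauForm_isSymm)
open B9Eq316AveragingTransposeZdPrinted (QQZdP withQQP QQZdP_of_reg17 reg17_shift)
open B9Eq327GreenZdHermPer (domSubHPer bondPairPer RegularAtHPer sum_box_pair_Jcur)
open B9Eq321LandauProjectionZdPer (perSub formPer projEPer projRPer isPeriodic_covDivB formPer_apply formPer_apply_self_eq_zero)
open B9SupplySockB9P3ZdAllLettersZdPer (opsAllZdPer opsLandauPer bondPairPer_deltaAOf_opsAllZdPer_eq_four_terms bondPairPer_DRDs_eq_formPer_sq
  regularAtHPer_opsAllZdPer_of_two_letters_pos)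
open B9SupplySockB9P3ZdGammaInAkDpZd (withDpZd)
open B9Eq369CurvSmallZd (DpZd)
open B9Eq326GaugeTermSquareZd (re_trace_star_pair_invariant)
open B9Thm311FlatPositivityZdPer (bondPairPer_QQZdP_eq_sum clsField_of_not_mem projRPer_covDivB_eq_coe)

-- `Site` alone could resolve to the torus sites of `Setup.lean`; re-export the `ℤ^d` sites of `B7Prop1Explicit`.
export B7Prop1Explicit (Site)

variable {d : ℕ} {𝔸 : Type*} [CStarAlgebra 𝔸]

/-! ## §1  The composite averaging `LʲηQ_j(U₀)` is `ℂ`-linear on ALL bond fields at a class bond, for `U₀` in the class (1.7) -/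

section Linear

variable {L : ℕ} [Nontrivial 𝔸]

omit [Nontrivial 𝔸] in
/-- `Lʲz ≤ Lʲz + (Lʲ−1) + [i=κ]Lʲ` coordinatewise (the box of a `j`-bond is non-degenerate, `L ≥ 1`). [folklore] -/
private theorem loK_le_bondHiK' (hL : 1 ≤ L) (j : ℕ) (z : Site d) (κ : Fin d) (i : Fin d) : loK L j z i ≤ bondHiK L j z κ i := by
  have hP : (1 : ℤ) ≤ (L : ℤ) ^ j := one_le_pow₀ (by exact_mod_cast hL)
  simp only [loK, bondHiK]
  split_ifs <;> omega

/-- the clamped extension `π^*U₀` at a class bond: unitary, globally `αL^{−2j}`-regular, agreeing with `U₀` on the box (the lineage's private `clamp_data`,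
re-copied). [cite: Balaban1985Averaging, p.24 (locality), Prop. 1 (51) p.26; Balaban1985RegularSpaces, (1.7) p.77] -/
private theorem clamp_data' (hL : 1 ≤ L) {m : ℕ} {Ω : ℕ → Set (Site d)} {α : ℝ} (hα : 0 < α)
    {U₀ : Site d → Fin d → 𝔸ˣ} (hU₀ : ∀ x κ, U₀ x κ ∈ unitaryUnits 𝔸) (hreg : Reg17 L m Ω α U₀)
    {j : ℕ} (hj : j ≤ m) (z : Site d) (κ : Fin d) (hbox : ∀ x, InBox (loK L j z) (bondHiK L j z κ) x → x ∈ Ω j) :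
    (∀ x ν, clampCfg (loK L j z) (bondHiK L j z κ) U₀ x ν ∈ unitaryUnits 𝔸) ∧
      pdev (clampCfg (loK L j z) (bondHiK L j z κ) U₀) < α * (((L : ℝ) ^ j)⁻¹) ^ 2 ∧
      AgreeOn (loK L j z) (bondHiK L j z κ) (clampCfg (loK L j z) (bondHiK L j z κ) U₀) U₀ := by
  have hU₀U1 : ∀ x μ, U₀ x μ ∈ U1 𝔸 := fun x μ => (avgClosed_unitaryUnits d L).le_U1 (hU₀ x μ)
  have hL0 : (0 : ℝ) < L := by exact_mod_cast hL
  refine ⟨clampCfg_mem hU₀, ?_, clampCfg_agree U₀⟩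
  have hpdOn : B7Prop1Local.pdevOn (loK L j z) (bondHiK L j z κ) U₀ < α * (((L : ℝ) ^ j)⁻¹) ^ 2 := by
    refine pdevOn_lt_of_forall (by positivity) fun x μ ν hx _ => ?_
    rcases eq_or_ne μ ν with rfl | hμν
    · rw [B7Prop2Explicit.hol_plaqWord_self, Units.val_one, sub_self, norm_zero]; positivity
    · exact hreg j hj x μ ν hμν (Or.inl (hbox x hx))
  exact (pdev_clampCfg_le (loK_le_bondHiK' hL j z κ) hU₀U1).trans_lt hpdOn

/-- ★ **THE COMPOSITE AVERAGING IS AFFINE ALONG COMPLEX LINES ON ALL BOND FIELDS AT A CLASS BOND** ([B7] p. 38 «Q_{j+1}(U₀) = Q(Ū₀ʲ)Q_j(U₀)», each factor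
linear in the regime): for a unitary `U₀` in the class (1.7) (`α ≤ α_Q`), a level-`j` bond `c = ⟨z, z+e_κ⟩` (`j ≤ m`) whose box lies in `Ω_j`, and ANY bond fields
`B, D`: `LʲηQ_j(U₀)(B + t·D)(c) = LʲηQ_j(U₀)B(c) + t·LʲηQ_j(U₀)D(c)` — lit-balaban's `linCovIter_line` at the clamped background, read back by locality
(`B9Ineq3137LocalSup.linCovIter_congr`). [cite: Balaban1985Averaging, p.38 (before (133)), (153) p.41, (147) p.40, p.24; Balaban1985RegularSpaces, (1.7) p.77] -/
theorem linCovIter_line_of_reg17 (hL : 2 ≤ L) {m : ℕ} {Ω : ℕ → Set (Site d)} {α : ℝ} (hα : 0 < α) (hαQ : α ≤ alphaQ d L)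
    {U₀ : Site d → Fin d → 𝔸ˣ} (hU₀ : ∀ x κ, U₀ x κ ∈ unitaryUnits 𝔸) (hreg : Reg17 L m Ω α U₀)
    {j : ℕ} (hj : j ≤ m) (z : Site d) (κ : Fin d) (hbox : ∀ x, InBox (loK L j z) (bondHiK L j z κ) x → x ∈ Ω j)
    (B D : Site d → Fin d → 𝔸) (t : ℂ) :
    linCovIter L U₀ (B + t • D) j z κ = linCovIter L U₀ B j z κ + t • linCovIter L U₀ D j z κ := by
  have hL1 : 1 ≤ L := le_trans (by norm_num) hL
  obtain ⟨hUG, hpdev, hag⟩ := clamp_data' hL1 hα hU₀ hreg hj z κ hbox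
  have hα3 : C0 d * α ≤ 1 / 3 := (mul_le_mul_of_nonneg_left hαQ (C0_pos d).le).trans (C0_mul_alphaQ_le d L)
  have hα4 : 4 * α ≤ c2' d L := by linarith [four_mul_alphaQ_le d L]
  set U' := clampCfg (loK L j z) (bondHiK L j z κ) U₀ with hU'
  have htr : ∀ F : Site d → Fin d → 𝔸, linCovIter L U₀ F j z κ = linCovIter L U' F j z κ :=
    fun F => B9Ineq3137LocalSup.linCovIter_congr L hL1 j z κ hag.symm (fun _ _ _ _ => rfl)
  rw [htr, htr, htr]
  exact linCovIter_line L U' j (hadd_levels L hL (avgClosed_unitaryUnits d L) j U' hUG hα hα3 hα4 hpdev)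
    (hsmul_levels L hL (avgClosed_unitaryUnits d L) j U' hUG hα hα3 hα4 hpdev) B D j le_rfl t z κ

/-- ★ **ADDITIVITY** of `LʲηQ_j(U₀)` on all bond fields at a class bond, `U₀` in the class (1.7). [cite: Balaban1985Averaging, p.38 (before (133)), (147) p.40] -/
theorem linCovIter_add_of_reg17 (hL : 2 ≤ L) {m : ℕ} {Ω : ℕ → Set (Site d)} {α : ℝ} (hα : 0 < α) (hαQ : α ≤ alphaQ d L)
    {U₀ : Site d → Fin d → 𝔸ˣ} (hU₀ : ∀ x κ, U₀ x κ ∈ unitaryUnits 𝔸) (hreg : Reg17 L m Ω α U₀)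
    {j : ℕ} (hj : j ≤ m) (z : Site d) (κ : Fin d) (hbox : ∀ x, InBox (loK L j z) (bondHiK L j z κ) x → x ∈ Ω j)
    (A B : Site d → Fin d → 𝔸) :
    linCovIter L U₀ (A + B) j z κ = linCovIter L U₀ A j z κ + linCovIter L U₀ B j z κ := by
  have h := linCovIter_line_of_reg17 hL hα hαQ hU₀ hreg hj z κ hbox A B 1
  rwa [one_smul, one_smul] at h

/-- ★ **`ℂ`-HOMOGENEITY** of `LʲηQ_j(U₀)` on all bond fields at a class bond, `U₀` in the class (1.7): `LʲηQ_j(U₀)(t·A)(c) = t·LʲηQ_j(U₀)A(c)`.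
[cite: Balaban1985Averaging, p.38 (before (133)), (147) p.40] -/
theorem linCovIter_csmul_of_reg17 (hL : 2 ≤ L) {m : ℕ} {Ω : ℕ → Set (Site d)} {α : ℝ} (hα : 0 < α) (hαQ : α ≤ alphaQ d L)
    {U₀ : Site d → Fin d → 𝔸ˣ} (hU₀ : ∀ x κ, U₀ x κ ∈ unitaryUnits 𝔸) (hreg : Reg17 L m Ω α U₀)
    {j : ℕ} (hj : j ≤ m) (z : Site d) (κ : Fin d) (hbox : ∀ x, InBox (loK L j z) (bondHiK L j z κ) x → x ∈ Ω j)
    (t : ℂ) (A : Site d → Fin d → 𝔸) :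
    linCovIter L U₀ (t • A) j z κ = t • linCovIter L U₀ A j z κ := by
  have h := linCovIter_line_of_reg17 hL hα hαQ hU₀ hreg hj z κ hbox 0 A t
  rwa [zero_add, congrFun (congrFun (B9SupplySockB9P3ZdAtBoundaryMode.linCovIter_zero_fun L U₀ j) z) κ, Pi.zero_apply, Pi.zero_apply,
    zero_add] at h

/-- ★ **THE LEVEL-`j` INPUT OF `Q*_j` IS `η·𝟙_{Λ_j}·(LʲQ_j(U₀)A)` AT EVERY CLASS BACKGROUND** (not only at `U₀ = 1`): the factor `−i` of `clsField` undoes the `i`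
of the exponent variable `iηA` by `ℂ`-homogeneity. [cite: Balaban1985BackgroundPropagators, (3.16) p.393; Balaban1985RegularSpaces, (1.56) p.86, (1.41) p.83] -/
theorem clsField_eq_smul_of_reg17 (hL : 2 ≤ L) {m : ℕ} {Ω : ℕ → Set (Site d)} {α : ℝ} (hα : 0 < α) (hαQ : α ≤ alphaQ d L)
    {U₀ : Site d → Fin d → 𝔸ˣ} (hU₀ : ∀ x κ, U₀ x κ ∈ unitaryUnits 𝔸) (hreg : Reg17 L m Ω α U₀)
    (ΛbP : ℕ → ℕ → Set (Site d × Fin d)) (η : ℝ) (m' : ℕ) {j : ℕ} (hj : j ≤ m)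
    (hbox : ∀ c ∈ ΛbP m' j, ∀ x, InBox (loK L j c.1) (bondHiK L j c.1 c.2) x → x ∈ Ω j)
    (A : Site d → Fin d → 𝔸) (z : Site d) (κ : Fin d) [Decidable ((z, κ) ∈ ΛbP m' j)] :
    clsField L ΛbP η m' j U₀ A z κ = if (z, κ) ∈ ΛbP m' j then (η : ℝ) • linCovIter L U₀ A j z κ else 0 := by
  classical
  simp only [clsField]
  split_ifs with hc
  · have hi : iEta η A = ((Complex.I : ℂ) * η) • A := by funext y τ'; rfl
    rw [hi, linCovIter_csmul_of_reg17 hL hα hαQ hU₀ hreg hj z κ (hbox (z, κ) hc) _ A, smul_smul, ← mul_assoc]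
    have : (-Complex.I * Complex.I * (η : ℂ)) = ((η : ℝ) : ℂ) := by rw [neg_mul, Complex.I_mul_I, neg_neg, one_mul]
    rw [this, Complex.coe_smul]
  · rfl

end Linear

/-! ## §2  On the torus: `⟨A, Q*aQ(U₀)A⟩_per` IS A SUM OF SQUARES at every periodic background of the class (1.7) -/

section Squares

variable (τ : 𝔸 →ₗ[ℂ] ℂ) [FiniteDimensional ℝ 𝔸] [Nontrivial 𝔸] {L : ℕ} (P : ℕ) [NeZero P]

omit [CStarAlgebra 𝔸] [FiniteDimensional ℝ 𝔸] [Nontrivial 𝔸] [NeZero P] in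
/-- `P = Lʲ·(P ∕ Lʲ)` over `ℤ` for `j ≤ m`, `Lᵐ ∣ P`. [folklore] -/
private theorem cast_eq_pow_mul_div' {m j : ℕ} (hdvd : L ^ m ∣ P) (hjm : j ≤ m) : (P : ℤ) = (L : ℤ) ^ j * ((P / L ^ j : ℕ) : ℤ) := by
  exact_mod_cast (Nat.mul_div_cancel' ((pow_dvd_pow L hjm).trans hdvd)).symm

omit [CStarAlgebra 𝔸] [FiniteDimensional ℝ 𝔸] [Nontrivial 𝔸] in
/-- the coarse period `P ∕ Lʲ` is non-zero. [folklore] -/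
private theorem neZero_div' {m j : ℕ} (hdvd : L ^ m ∣ P) (hjm : j ≤ m) : NeZero (P / L ^ j) := by
  refine ⟨(Nat.div_pos (Nat.le_of_dvd (Nat.pos_of_ne_zero (NeZero.ne P)) ((pow_dvd_pow L hjm).trans hdvd)) ?_).ne'⟩
  rcases Nat.eq_zero_or_pos (L ^ j) with h0 | hpos
  · exfalso
    have : (0 : ℕ) ∣ P := by rw [← h0]; exact (pow_dvd_pow L hjm).trans hdvd
    exact NeZero.ne P (Nat.eq_zero_of_zero_dvd this)
  · exact hpos

open Classical in
/-- ★★★ **[B9] (3.16)–(3.17) ON THE TORUS AT A CURVED BACKGROUND: `⟨A, Q*aQ(U₀)A⟩_per = η·Σ_{j≤m} w_j Σ_κ Σ_{y ∈ [0,P∕Lʲ)ᵈ, (y,κ) ∈ Λ_j} Re τ|(LʲηQ_j(U₀)A)(y,κ)|²`**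
for every `P`-periodic unitary `U₀` in the letter's regime (the class (1.7) at window `α_Q∕L²`), `Lᵐ ∣ P`, periodic class sections, class boxes in `Ω_{j−1}` ([B8] (1.31)),
and every `P`-periodic `A` — print's definition of the averaging term as a positively weighted sum of the squares `|Λ_jQ_j(U₀)A|²` read on `T^{(j)}` ([B8] (1.58)'s weights `w_j`), now at ANY
background of the class (the lineage's `bondPairPer_QQZdP_eq_sum` + §1's `ℂ`-homogeneity in the regime). [cite: Balaban1985BackgroundPropagators, (3.16)–(3.17) p.393; Balaban1985RegularSpaces, (1.56), (1.58) p.86, (1.31) p.82, (1.7) p.77, p.77 («Ω_j = T_η»); Balaban1985Averaging, (147) p.40] -/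
theorem bondPairPer_QQZdP_eq_squares (hL : 2 ≤ L) (hτp : ∀ a : 𝔸, a ≠ 0 → 0 < (τ (star a * a)).re) (hτs : ∀ a : 𝔸, τ (star a) = starRingEnd ℂ (τ a))
    (ΛbP : ℕ → ℕ → Set (Site d × Fin d)) (i : ZdIdx d L) {m : ℕ} (hdvd : L ^ m ∣ P)
    (hΛ : ∀ j, j ≤ m → ∀ κ : Fin d, IsPeriodic (P / L ^ j) (fun z => (z, κ) ∈ ΛbP m j))
    (hbox : ∀ j, j ≤ m → ∀ c ∈ ΛbP m j, ∀ x, InBox (loK L j c.1) (bondHiK L j c.1 c.2) x → x ∈ i.Ω (j - 1))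
    {U₀ : Site d → Fin d → 𝔸ˣ} (hU₀ : ∀ x κ, U₀ x κ ∈ unitaryUnits 𝔸) (hU : IsPeriodic P U₀) (hreg : Reg17 L m i.Ω (alphaQ d L / (L : ℝ) ^ 2) U₀)
    {A : Site d → Fin d → 𝔸} (hA : IsPeriodic P A) :
    bondPairPer τ P A (QQZdP τ L ΛbP i m U₀ A) =
      i.η * ∑ j ∈ Finset.range (m + 1), wQ (d := d) L i.η j *
        ∑ κ : Fin d, ∑ y ∈ box (d := d) (P / L ^ j),
          if (y, κ) ∈ ΛbP m j then (τ (star (linCovIter L U₀ A j y κ) * linCovIter L U₀ A j y κ)).re else 0 := by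
  have hL1 : 1 ≤ L := le_trans (by norm_num) hL
  have hαpos : 0 < alphaQ d L / (L : ℝ) ^ 2 * (L : ℝ) ^ 2 := by
    have := alphaQ_pos d hL1; positivity
  have hαle : alphaQ d L / (L : ℝ) ^ 2 * (L : ℝ) ^ 2 ≤ alphaQ d L := by
    rw [div_mul_cancel₀ _ (by positivity)]
  have hreg' := reg17_shift hL1 hreg
  rw [bondPairPer_QQZdP_eq_sum τ P hL hτp hτs ΛbP i hdvd hΛ hbox hU₀ hU hreg hA, Finset.mul_sum]
  refine Finset.sum_congr rfl fun j hj => ?_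
  have hjm : j ≤ m := Nat.lt_succ_iff.mp (Finset.mem_range.mp hj)
  rw [mul_left_comm]
  congr 1
  rw [Finset.mul_sum]
  refine Finset.sum_congr rfl fun κ _ => ?_
  rw [Finset.mul_sum]
  refine Finset.sum_congr rfl fun y _ => ?_
  rw [clsField_eq_smul_of_reg17 hL hαpos hαle hU₀ hreg' ΛbP i.η m hjm (hbox j hjm) A y κ]
  split_ifs with hc
  · rw [tauForm_apply, star_smul, star_trivial, smul_mul_assoc, ← Complex.coe_smul, map_smul, smul_eq_mul, Complex.re_ofReal_mul]
  · rw [map_zero, LinearMap.zero_apply, mul_zero]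

/-- ★★ **`⟨A, Q*aQ(U₀)A⟩_per ≥ 0` AT EVERY PERIODIC BACKGROUND OF THE CLASS** — the averaging term of (3.26) is positive semi-definite on the torus, not only at
`U₀ = 1` (same hypotheses). [cite: Balaban1985BackgroundPropagators, (3.16)–(3.17) p.393, Thm 3.11 p.416; Balaban1985RegularSpaces, p.77 («Ω_j = T_η»)] -/
theorem bondPairPer_QQZdP_nonneg (hL : 2 ≤ L) (hτp : ∀ a : 𝔸, a ≠ 0 → 0 < (τ (star a * a)).re) (hτs : ∀ a : 𝔸, τ (star a) = starRingEnd ℂ (τ a))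
    (ΛbP : ℕ → ℕ → Set (Site d × Fin d)) (i : ZdIdx d L) {m : ℕ} (hdvd : L ^ m ∣ P)
    (hΛ : ∀ j, j ≤ m → ∀ κ : Fin d, IsPeriodic (P / L ^ j) (fun z => (z, κ) ∈ ΛbP m j))
    (hbox : ∀ j, j ≤ m → ∀ c ∈ ΛbP m j, ∀ x, InBox (loK L j c.1) (bondHiK L j c.1 c.2) x → x ∈ i.Ω (j - 1))
    {U₀ : Site d → Fin d → 𝔸ˣ} (hU₀ : ∀ x κ, U₀ x κ ∈ unitaryUnits 𝔸) (hU : IsPeriodic P U₀) (hreg : Reg17 L m i.Ω (alphaQ d L / (L : ℝ) ^ 2) U₀)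
    {A : Site d → Fin d → 𝔸} (hA : IsPeriodic P A) :
    0 ≤ bondPairPer τ P A (QQZdP τ L ΛbP i m U₀ A) := by
  classical
  have hL1 : 1 ≤ L := le_trans (by norm_num) hL
  have nn := B9Thm311FlatHermKernelZd.re_trace_star_mul_self_nonneg' (τ := τ) hτp
  rw [bondPairPer_QQZdP_eq_squares τ P hL hτp hτs ΛbP i hdvd hΛ hbox hU₀ hU hreg hA]
  exact mul_nonneg i.hη.le (Finset.sum_nonneg fun j _ => mul_nonneg (B9Thm311FlatHermKernelZd.wQ_pos (d := d) hL1 i.hη j).le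
    (Finset.sum_nonneg fun κ _ => Finset.sum_nonneg fun y _ => by split_ifs; exacts [nn _, le_rfl]))

/-- ★★ **VANISHING OF THE AVERAGING TERM FORCES EVERY CLASS AVERAGE TO VANISH** (curved periodic `U₀` in the class; coarse cells): `⟨A, Q*aQ(U₀)A⟩_per ≤ 0` ⟹
`(LʲηQ_j(U₀)A)(y,κ) = 0` for `(y,κ) ∈ Λ_j`, `y ∈ [0,P∕Lʲ)ᵈ`, `j ≤ m`. [cite: Balaban1985BackgroundPropagators, (3.16)–(3.17) p.393, Thm 3.11 p.416; Balaban1985RegularSpaces, p.77 («Ω_j = T_η»)] -/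
theorem linCovIter_eq_zero_of_bondPairPer_QQZdP_nonpos (hL : 2 ≤ L) (hτp : ∀ a : 𝔸, a ≠ 0 → 0 < (τ (star a * a)).re)
    (hτs : ∀ a : 𝔸, τ (star a) = starRingEnd ℂ (τ a))
    (ΛbP : ℕ → ℕ → Set (Site d × Fin d)) (i : ZdIdx d L) {m : ℕ} (hdvd : L ^ m ∣ P)
    (hΛ : ∀ j, j ≤ m → ∀ κ : Fin d, IsPeriodic (P / L ^ j) (fun z => (z, κ) ∈ ΛbP m j))
    (hbox : ∀ j, j ≤ m → ∀ c ∈ ΛbP m j, ∀ x, InBox (loK L j c.1) (bondHiK L j c.1 c.2) x → x ∈ i.Ω (j - 1))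
    {U₀ : Site d → Fin d → 𝔸ˣ} (hU₀ : ∀ x κ, U₀ x κ ∈ unitaryUnits 𝔸) (hU : IsPeriodic P U₀) (hreg : Reg17 L m i.Ω (alphaQ d L / (L : ℝ) ^ 2) U₀)
    {A : Site d → Fin d → 𝔸} (hA : IsPeriodic P A) (h : bondPairPer τ P A (QQZdP τ L ΛbP i m U₀ A) ≤ 0) :
    ∀ j, j ≤ m → ∀ (κ : Fin d), ∀ y ∈ box (d := d) (P / L ^ j), (y, κ) ∈ ΛbP m j → linCovIter L U₀ A j y κ = 0 := by
  classical
  have hL1 : 1 ≤ L := le_trans (by norm_num) hL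
  have hη : 0 < i.η := i.hη
  have nn := B9Thm311FlatHermKernelZd.re_trace_star_mul_self_nonneg' (τ := τ) hτp
  rw [bondPairPer_QQZdP_eq_squares τ P hL hτp hτs ΛbP i hdvd hΛ hbox hU₀ hU hreg hA] at h
  have hS0 : 0 ≤ ∑ j ∈ Finset.range (m + 1), wQ (d := d) L i.η j *
      ∑ κ : Fin d, ∑ y ∈ box (d := d) (P / L ^ j),
        (if (y, κ) ∈ ΛbP m j then (τ (star (linCovIter L U₀ A j y κ) * linCovIter L U₀ A j y κ)).re else 0) :=
    Finset.sum_nonneg fun j _ => mul_nonneg (B9Thm311FlatHermKernelZd.wQ_pos (d := d) hL1 hη j).le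
      (Finset.sum_nonneg fun κ _ => Finset.sum_nonneg fun y _ => by split_ifs; exacts [nn _, le_rfl])
  have hSz : ∑ j ∈ Finset.range (m + 1), wQ (d := d) L i.η j *
      ∑ κ : Fin d, ∑ y ∈ box (d := d) (P / L ^ j),
        (if (y, κ) ∈ ΛbP m j then (τ (star (linCovIter L U₀ A j y κ) * linCovIter L U₀ A j y κ)).re else 0) = 0 := by
    nlinarith [mul_nonneg hη.le hS0]
  intro j hj κ y hy hmem
  have h1 := (Finset.sum_eq_zero_iff_of_nonneg fun j _ => mul_nonneg (B9Thm311FlatHermKernelZd.wQ_pos (d := d) hL1 hη j).le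
    (Finset.sum_nonneg fun κ _ => Finset.sum_nonneg fun y _ => by split_ifs; exacts [nn _, le_rfl])).1 hSz j
    (Finset.mem_range.2 (Nat.lt_succ_of_le hj))
  have h2 : ∑ κ : Fin d, ∑ y ∈ box (d := d) (P / L ^ j),
      (if (y, κ) ∈ ΛbP m j then (τ (star (linCovIter L U₀ A j y κ) * linCovIter L U₀ A j y κ)).re else 0) = 0 := by
    rcases mul_eq_zero.1 h1 with h0 | h0
    · exact absurd h0 (B9Thm311FlatHermKernelZd.wQ_pos (d := d) hL1 hη j).ne'
    · exact h0
  have h3 := (Finset.sum_eq_zero_iff_of_nonneg fun κ _ => Finset.sum_nonneg fun y _ => by split_ifs; exacts [nn _, le_rfl]).1 h2 κ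
    (Finset.mem_univ κ)
  have h4 := (Finset.sum_eq_zero_iff_of_nonneg fun y _ => by split_ifs; exacts [nn _, le_rfl]).1 h3 y hy
  rw [if_pos hmem] at h4
  exact B9Thm311FlatHermKernelZd.eq_zero_of_re_trace_star_mul_self_eq_zero hτp h4

end Squares

/-! ## §3  The curvature letter `Δ′(U₀)` VANISHES AT EVERY FLAT BACKGROUND (all plaquette variables `1` — trivial or non-trivial holonomy) -/

section Flat

/-- ★ **`Δ′(U₀) = 0` WHENEVER ALL PLAQUETTE VARIABLES OF `U₀` ARE `1`** ([B9] (3.10): every letter of `Δ′` carries a factor `Re U(∂p) − 1` or `Im U(∂p)`):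
the flat backgrounds of the torus — including those with non-trivial holonomy around the cycles, which are NOT gauge-equivalent to `1` — have no curvature
term, exactly like `U₀ = 1` (`B9Eq369CurvSmallZd.DpZd_one`). [cite: Balaban1985BackgroundPropagators, (3.10) p.392, (3.1)–(3.2) p.390] -/
theorem DpZd_eq_zero_of_plaqF_eq_one (η : ℝ) {U₀ : Site d → Fin d → 𝔸ˣ} (hflat : ∀ (κ ν : Fin d) (x : Site d), plaqF U₀ κ ν x = 1)
    (A : Site d → Fin d → 𝔸) : DpZd η U₀ A = 0 := by
  funext x μ
  change deltaPrimeOp (shiftT d) (byDir U₀) η (byDir A) μ x = 0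
  have hp : ∀ κ ν y, plaqU (shiftT d) (byDir U₀) κ ν y = 1 := by
    intro κ ν y
    ext
    rw [B9Eq369CurvSmallZd.val_plaqU_shiftT_byDir, hflat, Units.val_one]
  have hz : ∀ κ ν y, B9Eq310Hermitian.zP (shiftT d) (byDir U₀) η κ ν y = 0 := by
    intro κ ν y
    simp only [B9Eq310Hermitian.zP, hp, B9Eq37Insertion.reC, Units.val_one, inv_one, B9Eq369Small.half_smul_one_add_one,
      sub_self, smul_zero]
  have hy : ∀ κ ν y, B9Eq310Hermitian.yP (shiftT d) (byDir U₀) η κ ν y = 0 := by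
    intro κ ν y
    simp only [B9Eq310Hermitian.yP, hp, B9Eq37Insertion.imC, Units.val_one, inv_one, sub_self, smul_zero]
  have hJ : ∀ κ ν, B9Eq310Hermitian.jordanF (shiftT d) (byDir U₀) η (byDir A) κ ν = 0 := by
    intro κ ν; funext y; simp [B9Eq310Hermitian.jordanF, hz]
  have hG₁ : ∀ κ ν, B9Eq310Hermitian.commG₁ (shiftT d) (byDir U₀) η (byDir A) κ ν = 0 := by
    intro κ ν; funext y; simp [B9Eq310Hermitian.commG₁, hy]
  have hG₂ : ∀ κ ν, B9Eq310Hermitian.commG₂ (shiftT d) (byDir U₀) η (byDir A) κ ν = 0 := by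
    intro κ ν; funext y; simp [B9Eq310Hermitian.commG₂, hy]
  have hG₃ : ∀ κ ν, B9Eq310Hermitian.commG₃ (shiftT d) (byDir U₀) η (byDir A) κ ν = 0 := by
    intro κ ν; funext y; simp [B9Eq310Hermitian.commG₃, hy]
  have hG₄ : ∀ κ ν, B9Eq310Hermitian.commG₄ (shiftT d) (byDir U₀) η (byDir A) κ ν = 0 := by
    intro κ ν; funext y; simp [B9Eq310Hermitian.commG₄, hy]
  simp [deltaPrimeOp, B9Eq39Adjoint.divP, B9Eq310Hermitian.divL, hJ, hG₁, hG₂, hG₃, hG₄, B9Eq39Adjoint.covDstar, B9Eq39Adjoint.R]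

variable {L : ℕ}

/-- a flat background lies in the class (1.7) at every window `α > 0` and every truncation. [cite: Balaban1985RegularSpaces, (1.7) p.77] -/
theorem reg17_of_plaqF_eq_one (hL : 1 ≤ L) (m : ℕ) (Ω : ℕ → Set (Site d)) {α : ℝ} (hα : 0 < α) {U₀ : Site d → Fin d → 𝔸ˣ}
    (hflat : ∀ (κ ν : Fin d) (x : Site d), plaqF U₀ κ ν x = 1) : Reg17 L m Ω α U₀ := by
  intro j _ x μ ν _ _
  have hL0 : (0 : ℝ) < L := by exact_mod_cast hL
  rw [hflat, sub_self, norm_zero]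
  positivity

end Flat

/-! ## §4  The genuine torus record at a curved ∕ flat periodic background: the form as squares plus the curvature term; the flat kernel conditions -/

section Record

variable (τ : 𝔸 →ₗ[ℂ] ℂ) [FiniteDimensional ℝ 𝔸] [Nontrivial 𝔸] {L : ℕ} (P : ℕ) [NeZero P]

open Classical in
/-- ★★ **`⟨A, Δ_a(U₀)A⟩_per` OF THE GENUINE TORUS RECORD AT A PERIODIC BACKGROUND OF THE CLASS = THREE SQUARES + THE CURVATURE TERM**:
`Σ_κΣ_{ν<κ}Σ_cell Re τ|(D^η_{U₀}A)_{νκ}|² + ⟨A, Δ′(U₀)A⟩_per + ⟨R^per(U₀)D^{η*}_{U₀}A, R^per(U₀)D^{η*}_{U₀}A⟩_per + η·Σ_j w_j Σ Re τ|LʲηQ_j(U₀)A|²` (FILE p638598's energy identity, p641100's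
Landau square, §2) — so Theorem 3.11's positivity at a curved `U₀` is the statement that the SIGNED curvature term is dominated by the three squares.
[cite: Balaban1985BackgroundPropagators, (3.26) p.395, (3.10) p.392, (3.16) p.393, (3.20)–(3.22) p.394, Thm 3.11 p.416; Balaban1985RegularSpaces, p.77 («Ω_j = T_η»)] -/
theorem bondPairPer_deltaAOf_opsAllZdPer_eq_squares (hτt : ∀ a b : 𝔸, τ (a * b) = τ (b * a))
    (hτs : ∀ a : 𝔸, τ (star a) = starRingEnd ℂ (τ a)) (hτp : ∀ a : 𝔸, a ≠ 0 → 0 < (τ (star a * a)).re)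
    (hL : 2 ≤ L) (ΛbP : ℕ → ℕ → Set (Site d × Fin d)) (ops₀ : ℝ → ZdIdx d L → ℕ → OpsZd d 𝔸) (M : ℝ) (i : ZdIdx d L) {m : ℕ}
    (hdvd : L ^ m ∣ P) (hΛ : ∀ j, j ≤ m → ∀ κ : Fin d, IsPeriodic (P / L ^ j) (fun z => (z, κ) ∈ ΛbP m j))
    (hbox : ∀ j, j ≤ m → ∀ c ∈ ΛbP m j, ∀ x, InBox (loK L j c.1) (bondHiK L j c.1 c.2) x → x ∈ i.Ω (j - 1))
    {U₀ : Site d → Fin d → 𝔸ˣ} (hU₀ : ∀ x κ, U₀ x κ ∈ unitaryUnits 𝔸) (hU : IsPeriodic P U₀) (hreg : Reg17 L m i.Ω (alphaQ d L / (L : ℝ) ^ 2) U₀)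
    {A : Site d → Fin d → 𝔸} (hA : IsPeriodic P A) :
    bondPairPer τ P A (deltaAOf i.η (opsAllZdPer τ L P ΛbP ops₀ M i m) U₀ A) =
      (∑ κ : Fin d, ∑ ν ∈ Finset.Iio κ, ∑ x ∈ box (d := d) P,
          (τ (star (plaqCovDeriv i.η U₀ A ν κ x) * plaqCovDeriv i.η U₀ A ν κ x)).re) +
        bondPairPer τ P A (DpZd i.η U₀ A) +
        formPer τ P (projEPer τ P L m i.η (i.Λs m) U₀ ⟨covDivB i.η U₀ A, isPeriodic_covDivB hU hA⟩)
          (projEPer τ P L m i.η (i.Λs m) U₀ ⟨covDivB i.η U₀ A, isPeriodic_covDivB hU hA⟩) +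
        i.η * ∑ j ∈ Finset.range (m + 1), wQ (d := d) L i.η j *
          ∑ κ : Fin d, ∑ y ∈ box (d := d) (P / L ^ j),
            (if (y, κ) ∈ ΛbP m j then (τ (star (linCovIter L U₀ A j y κ) * linCovIter L U₀ A j y κ)).re else 0) := by
  have hB : ∀ u ∈ unitaryUnits 𝔸, ∀ a b : 𝔸, tauForm τ (conjR u a) b = tauForm τ a (conjR u⁻¹ b) :=
    fun u hu a b => by rw [tauForm_apply, tauForm_apply]; exact re_trace_star_pair_invariant τ hτt hu a b
  have hT1 := sum_box_pair_Jcur (tauForm τ) (unitaryUnits 𝔸) P i.η U₀ hB hU₀ hU hA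
  simp only [tauForm_apply] at hT1
  rw [bondPairPer_deltaAOf_opsAllZdPer_eq_four_terms P τ ΛbP ops₀ M i m U₀ A, hT1,
    bondPairPer_DRDs_eq_formPer_sq P τ hτt hτs hτp (withDpZd (withQQP τ L ΛbP ops₀)) M i m hU₀ hU hA,
    bondPairPer_QQZdP_eq_squares τ P hL hτp hτs ΛbP i hdvd hΛ hbox hU₀ hU hreg hA]

/-- ★★ **THE SIGNED-TERM REDUCTION OF THEOREM 3.11 ON THE TORUS**: at a periodic unitary `U₀`, if for every `0 ≠ A ∈ E_𝔤^per(P)` the curvature term is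
dominated, `−⟨A, Δ′(U₀)A⟩_per < Σ|D^η_{U₀}A|² + ‖R^per D*A‖²_per + η Σ_j w_j Σ|LʲηQ_j(U₀)A|²`, then `Δ_a(U₀)` of the genuine record is invertible on `E_𝔤^per(P)`
(`RegularAtHPer`) — p641100's `regularAtHPer_opsAllZdPer_of_two_letters_pos` with the averaging term moved to the positive side by §2.
[cite: Balaban1985BackgroundPropagators, Thm 3.11 p.416, (3.26)–(3.27) p.395, (3.10) p.392; Balaban1985RegularSpaces, (1.58) p.86, p.77 («Ω_j = T_η»)] -/
theorem regularAtHPer_opsAllZdPer_of_curv_dominated (hτt : ∀ a b : 𝔸, τ (a * b) = τ (b * a))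
    (hτs : ∀ a : 𝔸, τ (star a) = starRingEnd ℂ (τ a)) (hτp : ∀ a : 𝔸, a ≠ 0 → 0 < (τ (star a * a)).re)
    (hL : 2 ≤ L) (ΛbP : ℕ → ℕ → Set (Site d × Fin d)) (ops₀ : ℝ → ZdIdx d L → ℕ → OpsZd d 𝔸) (M : ℝ) (i : ZdIdx d L) {m : ℕ}
    (hdvd : L ^ m ∣ P) (hΛ : ∀ j, j ≤ m → ∀ κ : Fin d, IsPeriodic (P / L ^ j) (fun z => (z, κ) ∈ ΛbP m j))
    (hbox : ∀ j, j ≤ m → ∀ c ∈ ΛbP m j, ∀ x, InBox (loK L j c.1) (bondHiK L j c.1 c.2) x → x ∈ i.Ω (j - 1))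
    {U₀ : Site d → Fin d → 𝔸ˣ} (hU₀ : ∀ x κ, U₀ x κ ∈ unitaryUnits 𝔸) (hU : IsPeriodic P U₀)
    (hdom : ∀ A ∈ domSubHPer (d := d) (𝔸 := 𝔸) P, A ≠ 0 →
      -bondPairPer τ P A (DpZd i.η U₀ A) <
        (∑ μ : Fin d, ∑ x ∈ box (d := d) P, (τ (star (A x μ) * Jcur i.η U₀ A μ x)).re) +
          bondPairPer τ P A ((opsLandauPer τ P (withDpZd (withQQP τ L ΛbP ops₀)) M i m).DRDs U₀ A) +
          bondPairPer τ P A (QQZdP τ L ΛbP i m U₀ A)) :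
    RegularAtHPer i.η (opsLandauPer τ P (withDpZd (withQQP τ L ΛbP ops₀)) M i m) P U₀ := by
  have hbox1 : ∀ j, 1 ≤ j → j ≤ m → ∀ c ∈ ΛbP m j, ∀ x, InBox (loK L j c.1) (bondHiK L j c.1 c.2) x → x ∈ i.Ω (j - 1) :=
    fun j _ hj c hc x hx => hbox j hj c hc x hx
  refine regularAtHPer_opsAllZdPer_of_two_letters_pos τ P hL hτp hτt hτs ΛbP ops₀ M i hU₀ hU hdvd hΛ hbox1 fun A hA hA0 => ?_
  have h := hdom A hA hA0
  linarith

open Classical in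
/-- ★★★ **THE KERNEL CONDITIONS AT A FLAT BACKGROUND WITH ARBITRARY HOLONOMY** (the starting point of Theorem 3.11 on `T_P` beyond the gauge orbit of `1`): at a
`P`-periodic unitary `U₀` with ALL PLAQUETTE VARIABLES `1` (e.g. constant commuting `U₀(x,μ) = u_μ`), `Lᵐ ∣ P`, periodic class sections, class boxes in `Ω_{j−1}`, a
`P`-periodic `A` with `⟨A, Δ_a(U₀)A⟩_per ≤ 0` for the genuine torus record is (a) COVARIANTLY CLOSED on the cell (`(D^η_{U₀}A)_{νκ}(x) = 0`, `ν < κ`), (b) has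
vanishing periodic Landau projection `R^per(U₀)(D^{η*}_{U₀}A) = 0`, (c) has all class averages `LʲηQ_j(U₀)A` vanishing on the coarse cells — §3 kills the curvature term,
the other three are squares (§4).  What Theorem 3.11 at such `U₀` still needs is the twisted Hodge kernel on `T_P` (not here).
[cite: Balaban1985BackgroundPropagators, Thm 3.11 p.416, (3.26) p.395, (3.10) p.392, (3.16) p.393, (3.20)–(3.22) p.394; Balaban1984PropagatorsI, (1.72) p.30; Balaban1985RegularSpaces, p.77 («Ω_j = T_η»)] -/
theorem kernel_conditions_per_of_flat_of_bondPairPer_nonpos (hτt : ∀ a b : 𝔸, τ (a * b) = τ (b * a))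
    (hτs : ∀ a : 𝔸, τ (star a) = starRingEnd ℂ (τ a)) (hτp : ∀ a : 𝔸, a ≠ 0 → 0 < (τ (star a * a)).re)
    (hL : 2 ≤ L) (ΛbP : ℕ → ℕ → Set (Site d × Fin d)) (ops₀ : ℝ → ZdIdx d L → ℕ → OpsZd d 𝔸) (M : ℝ) (i : ZdIdx d L) {m : ℕ}
    (hdvd : L ^ m ∣ P) (hΛ : ∀ j, j ≤ m → ∀ κ : Fin d, IsPeriodic (P / L ^ j) (fun z => (z, κ) ∈ ΛbP m j))
    (hbox : ∀ j, j ≤ m → ∀ c ∈ ΛbP m j, ∀ x, InBox (loK L j c.1) (bondHiK L j c.1 c.2) x → x ∈ i.Ω (j - 1))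
    {U₀ : Site d → Fin d → 𝔸ˣ} (hU₀ : ∀ x κ, U₀ x κ ∈ unitaryUnits 𝔸) (hU : IsPeriodic P U₀)
    (hflat : ∀ (κ ν : Fin d) (x : Site d), plaqF U₀ κ ν x = 1)
    {A : Site d → Fin d → 𝔸} (hA : IsPeriodic P A)
    (h : bondPairPer τ P A (deltaAOf i.η (opsAllZdPer τ L P ΛbP ops₀ M i m) U₀ A) ≤ 0) :
    (∀ (κ : Fin d), ∀ ν ∈ Finset.Iio κ, ∀ x ∈ box (d := d) P, plaqCovDeriv i.η U₀ A ν κ x = 0) ∧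
      projRPer τ P L m i.η (i.Λs m) U₀ (covDivB i.η U₀ A) = 0 ∧
      (∀ j, j ≤ m → ∀ (κ : Fin d), ∀ y ∈ box (d := d) (P / L ^ j), (y, κ) ∈ ΛbP m j → linCovIter L U₀ A j y κ = 0) := by
  have hL1 : 1 ≤ L := le_trans (by norm_num) hL
  have hη : 0 < i.η := i.hη
  have nn := B9Thm311FlatHermKernelZd.re_trace_star_mul_self_nonneg' (τ := τ) hτp
  have hreg : Reg17 L m i.Ω (alphaQ d L / (L : ℝ) ^ 2) U₀ :=
    reg17_of_plaqF_eq_one hL1 m i.Ω (div_pos (alphaQ_pos d hL1) (by positivity)) hflat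
  rw [bondPairPer_deltaAOf_opsAllZdPer_eq_squares τ P hτt hτs hτp hL ΛbP ops₀ M i hdvd hΛ hbox hU₀ hU hreg hA,
    DpZd_eq_zero_of_plaqF_eq_one i.η hflat A, B9Eq327GreenZdHermPer.bondPairPer_zero_right, add_zero] at h
  set Rf := projEPer τ P L m i.η (i.Λs m) U₀ ⟨covDivB i.η U₀ A, isPeriodic_covDivB hU hA⟩ with hRf
  have hT1nn : 0 ≤ ∑ κ : Fin d, ∑ ν ∈ Finset.Iio κ, ∑ x ∈ box (d := d) P,
      (τ (star (plaqCovDeriv i.η U₀ A ν κ x) * plaqCovDeriv i.η U₀ A ν κ x)).re :=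
    Finset.sum_nonneg fun κ _ => Finset.sum_nonneg fun ν _ => Finset.sum_nonneg fun x _ => nn _
  have hT3nn : 0 ≤ formPer τ P Rf Rf := by
    rw [formPer_apply]; exact Finset.sum_nonneg fun x _ => nn _
  have hT4nn : 0 ≤ ∑ j ∈ Finset.range (m + 1), wQ (d := d) L i.η j *
      ∑ κ : Fin d, ∑ y ∈ box (d := d) (P / L ^ j),
        (if (y, κ) ∈ ΛbP m j then (τ (star (linCovIter L U₀ A j y κ) * linCovIter L U₀ A j y κ)).re else 0) :=
    Finset.sum_nonneg fun j _ => mul_nonneg (B9Thm311FlatHermKernelZd.wQ_pos (d := d) hL1 hη j).le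
      (Finset.sum_nonneg fun κ _ => Finset.sum_nonneg fun y _ => by split_ifs; exacts [nn _, le_rfl])
  have hT1z : ∑ κ : Fin d, ∑ ν ∈ Finset.Iio κ, ∑ x ∈ box (d := d) P,
      (τ (star (plaqCovDeriv i.η U₀ A ν κ x) * plaqCovDeriv i.η U₀ A ν κ x)).re = 0 := by
    nlinarith [mul_nonneg hη.le hT4nn]
  have hT3z : formPer τ P Rf Rf = 0 := by nlinarith [mul_nonneg hη.le hT4nn]
  have hT4z : i.η * ∑ j ∈ Finset.range (m + 1), wQ (d := d) L i.η j *
      ∑ κ : Fin d, ∑ y ∈ box (d := d) (P / L ^ j),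
        (if (y, κ) ∈ ΛbP m j then (τ (star (linCovIter L U₀ A j y κ) * linCovIter L U₀ A j y κ)).re else 0) ≤ 0 := by
    nlinarith [mul_nonneg hη.le hT4nn]
  refine ⟨fun κ ν hν x hx => ?_, ?_, ?_⟩
  · have h1 := (Finset.sum_eq_zero_iff_of_nonneg fun κ _ =>
      Finset.sum_nonneg fun ν _ => Finset.sum_nonneg fun x _ => nn _).1 hT1z κ (Finset.mem_univ κ)
    have h2 := (Finset.sum_eq_zero_iff_of_nonneg fun ν _ => Finset.sum_nonneg fun x _ => nn _).1 h1 ν hν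
    have h3 := (Finset.sum_eq_zero_iff_of_nonneg fun x _ => nn _).1 h2 x hx
    exact B9Thm311FlatHermKernelZd.eq_zero_of_re_trace_star_mul_self_eq_zero hτp h3
  · rw [projRPer_covDivB_eq_coe τ P L m i.η (i.Λs m) hU hA, ← hRf, formPer_apply_self_eq_zero τ P hτp hT3z, Submodule.coe_zero]
  · have hQQ : bondPairPer τ P A (QQZdP τ L ΛbP i m U₀ A) ≤ 0 := by
      rw [bondPairPer_QQZdP_eq_squares τ P hL hτp hτs ΛbP i hdvd hΛ hbox hU₀ hU hreg hA]; exact hT4z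
    exact linCovIter_eq_zero_of_bondPairPer_QQZdP_nonpos τ P hL hτp hτs ΛbP i hdvd hΛ hbox hU₀ hU hreg hA hQQ

end Record

end Literature.MathematicalPhysics.QuantumFieldTheory.Balaban1983to89.B9Eq316AveragingSquaresZdPer

end
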